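import Mathlib.Data.Nat.Cast.Defs
import Mathlib.LinearAlgebra.BilinearForm.IsometryEquiv
import Mathlib.Geometry.Manifold.Instances.Real
import Mathlib.AlgebraicTopology.FundamentalGroupoid.SimplyConnected
import Literature.AlgebraicTopology.SingularHomology.Orientation
import Literature.AlgebraicTopology.SingularHomology.FundamentalClass
import Literature.AlgebraicTopology.SingularHomology.PoincareDuality
import Literature.AlgebraicTopology.SingularHomology.IntersectionForm
import Literature.Topology.FourManifolds.LatticeForms
import Literature.Topology.FourManifolds.SmoothOrientation
import HarnessLib

-- D-0014 sorry-sweep (operator, 2026-08-13): sorried theorems -> named facts `def X : Prop`; partial proofs preserved in comments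
-- provenance: harness21/H21/H21/Prelude/FourManM/IntersectionLattice.lean @ 6264bac (interim HEAD d8f2665); M5 mechanical rewrite
/-!
# The intersection lattice of a closed oriented manifold (trunk T-4MAN, item C3)

This file is the thin *transport layer* between the honest intersection form of trunk G04
(`Literature.intersectionForm h μ : LinearMap.BilinForm ℤ ↥(freeCohomology ℤ X k)`, for a closed
`ℤ`-oriented topological manifold `X` of dimension `n = k + k`, file
`Literature.Prelude.AlgTop.IntersectionForm`) and the integral-lattice vocabulary of
`Literature.Prelude.FourManM.LatticeForms` (`IsUnimodular`, `IsEven`, `signature`, ...), as consumed by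
the 4-manifold statements (Freedman, Donaldson, Rokhlin, 11/8).

## Informal content

* The intersection form `Q_X` of a closed oriented `2k`-manifold is unimodular (Poincaré duality);
  reversing the orientation replaces `Q_X` by `-Q_X`, hence negates the signature and preserves the
  parity; a homeomorphism `e : Y ≃ₜ X` (with the transported orientation on `Y`) induces an
  isometry of intersection forms, hence preserves signature and parity; on a connected manifold
  there are only the two orientations `±μ`, so `|σ|` and the parity do not depend on the
  orientation.
* For a closed oriented topological `4`-manifold `(M, μ)` the *signature* `σ(M, μ) := σ(Q_M)`.
* A smooth manifold is orientable in the smooth sense (consistent orientations of the tangent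
  spaces) iff it is `ℤ`-orientable in the homological sense (consistent generators of
  `Hₙ(M | x; ℤ)`); a simply connected manifold is `ℤ`-orientable.

## Sources

* J. Milnor, D. Husemoller, *Symmetric Bilinear Forms* (Springer 1973), §II (signature, type),
  §V.1 (intersection forms of manifolds).
* R. Gompf, A. Stipsicz, *4-Manifolds and Kirby Calculus* (AMS 1999), §1.2, in particular 1.2.6
  (signature of a 4-manifold) and the remarks after Def. 1.2.1 (orientation reversal,
  homeomorphism invariance).
* G. Bredon, *Topology and Geometry* (GTM 139, 1993), §VI.7 (smooth vs homological orientation);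
  J. Milnor, J. Stasheff, *Characteristic Classes* (1974), Appendix A.

## Mathlib

Mathlib (pinned) has no intersection form, no signature of a manifold and no orientability of
manifolds (searched `intersectionForm`, `signature`, `orientable` in `Mathlib/Geometry/Manifold`,
`Mathlib/AlgebraicTopology`). Used from Mathlib as is: `LinearMap.BilinForm.Equivalent`,
`LinearMap.IsPerfPair`, root-level `sigPos`/`sigNeg`, `Module.finrank`, and the root lemma
`two_add_two_eq_four` (`Mathlib/Data/Nat/Cast/Defs.lean`) as the degree equation `2 + 2 = 4`
(by proof irrelevance `intersectionForm two_add_two_eq_four μ` is definitionally the form used in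
the SPC4 statement files).

## Design choices

* No new structure (outline Design 1, review #4: `IntersectionFormData` is dropped): everything
  is a lemma about `Literature.intersectionForm h μ` or an abbreviation of it.
* ℤ-instance discipline (AlgTop outline §1): no binder `[Module ℤ ↥(freeCohomology …)]` appears;
  the carrier `↥(freeCohomology ℤ X k)` is used at its inferred `ModuleCat` instances.
* `Literature.HomologicalOrientation.signature μ` is an `abbrev` placed in the namespace of G04's
  structure `Literature.AlgebraicTopology.SingularHomology.HomologicalOrientation` (a deliberate dot-notation extension inside `Literature`), with
  only `[TopologicalSpace M]` as hypothesis, like `Literature.AlgebraicTopology.SingularHomology.intersectionForm`; the manifold hypotheses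
  appear on the lemmas. Parity is always written `.IsEven` on the form (no abbreviation).
* The helpers `LinearMap.BilinForm.isEven_neg_iff`, `LinearMap.BilinForm.isEven_iff_of_equivalent_neg`
  are deliberate dot-notation extensions of Mathlib's `LinearMap.BilinForm` namespace, continuing
  `Literature.Prelude.FourManM.LatticeForms` (no clash with a Mathlib name).
* The bridge smooth ↔ homological orientation is stated as sorried theorems (known results,
  Bredon VI.7); the convenience `nonempty_homologicalOrientation_int_of_simplyConnectedSpace` is
  G04's `isOrientableOver_int_of_simplyConnectedSpace` unfolded.
-/

noncomputable section

open scoped Manifold ContDiff Topology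
open LinearMap.BilinForm

universe u

/-! ### Two lattice helpers (dot notation on Mathlib's `LinearMap.BilinForm`) -/

namespace LinearMap.BilinForm

variable {V W : Type*} [AddCommGroup V] [Module ℤ V] [AddCommGroup W] [Module ℤ W]

/-- Negating a form does not change its parity: `-Q` is even iff `Q` is even
(Milnor–Husemoller 1973, §I.3 and §II.2). [cite: MilnorHusemoller1973, §I.3 and §II.2] -/
theorem isEven_neg_iff (Q : LinearMap.BilinForm ℤ V) : (-Q).IsEven ↔ Q.IsEven :=
  forall_congr' fun x ↦ by simp only [LinearMap.neg_apply, even_neg]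

/-- If `Q` is isometric to `-Q'` then `Q` and `Q'` have the same parity (type); helper for
statements of the form "`Q_M ≅ Q_N` or `Q_M ≅ -Q_N`" (Milnor–Husemoller 1973, §I.3, §II.2). [cite: MilnorHusemoller1973, §I.3  §II.2] -/
theorem isEven_iff_of_equivalent_neg (Q : LinearMap.BilinForm ℤ V) (Q' : LinearMap.BilinForm ℤ W)
    (h : Q.Equivalent (-Q')) : Q.IsEven ↔ Q'.IsEven :=
  (isEven_iff_of_equivalent h).trans Q'.isEven_neg_iff

end LinearMap.BilinForm

namespace Literature.Topology.FourManifolds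

/-- Local notation: `𝔼 n` is the model Euclidean space `EuclideanSpace ℝ (Fin n)`. -/
local notation "𝔼 " n:arg => EuclideanSpace ℝ (Fin n)

/-! ### Generic transport lemmas in dimension `n = k + k` -/

section Transport

variable {X : Type u} [TopologicalSpace X] [CompactSpace X] [T2Space X] {k n : ℕ}
  [ChartedSpace (𝔼 n) X] {Y : Type u} [TopologicalSpace Y]

-- Binder repair (2026-08-16): the header instance deliberately shadows the section's, which a
-- `def` does not capture (it ranged too widely before); the overlapping-instances linter is moot.
set_option linter.overlappingInstances false in
/-- **Unimodularity.** The intersection form of a closed `ℤ`-oriented topological `2k`-manifold is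
unimodular (Milnor–Husemoller 1973, §V.1, Thm. 1.1; Gompf–Stipsicz 1999, §1.2). This is G04's
`isPerfPair_intersectionForm` in the vocabulary of `LatticeForms`. [cite: MilnorHusemoller1973, §V.1  Thm. 1.1]
(Binder repair 2026-08-16: `[CompactSpace X] [T2Space X]` is written in the header so that it is a
parameter of the elaborated constant; as a section instance unused by the body it was silently
dropped, so the fact ranged over cases the printed theorem excludes.) -/
def isUnimodular_intersectionForm [CompactSpace X] [T2Space X] : Prop :=
  ∀ (h : k + k = n) (μ : Literature.AlgebraicTopology.SingularHomology.HomologicalOrientation ℤ X n),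
    (Literature.AlgebraicTopology.SingularHomology.intersectionForm h μ).IsUnimodular

/- interim proof relied on results that are now named facts (D-0014); demoted to a fact by the D-0014 sorry-sweep, proof preserved:
:=
  isPerfPair_intersectionForm h μ
-/

-- Binder repair (2026-08-16): the header instance deliberately shadows the section's, which a
-- `def` does not capture (it ranged too widely before); the overlapping-instances linter is moot.
set_option linter.overlappingInstances false in
/-- **Orientation reversal negates the signature**: `σ(Q_{-X}) = -σ(Q_X)`
(Milnor–Husemoller 1973, §II.2 and §V.1; Gompf–Stipsicz 1999, §1.2, remark after Def. 1.2.1). [cite: MilnorHusemoller1973, §II.2 and §V.1]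
(Binder repair 2026-08-16: `[CompactSpace X] [T2Space X]` is written in the header so that it is a
parameter of the elaborated constant; as a section instance unused by the body it was silently
dropped, so the fact ranged over cases the printed theorem excludes.) -/
def signature_intersectionForm_neg [CompactSpace X] [T2Space X] : Prop :=
  ∀ (h : k + k = n) (μ : Literature.AlgebraicTopology.SingularHomology.HomologicalOrientation ℤ X n),
    (Literature.AlgebraicTopology.SingularHomology.intersectionForm h (-μ)).signature = -(Literature.AlgebraicTopology.SingularHomology.intersectionForm h μ).signature

/- interim proof relied on results that are now named facts (D-0014); demoted to a fact by the D-0014 sorry-sweep, proof preserved: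
:= by
  rw [intersectionForm_neg, LinearMap.BilinForm.signature_neg]
-/

-- Binder repair (2026-08-16): the header instance deliberately shadows the section's, which a
-- `def` does not capture (it ranged too widely before); the overlapping-instances linter is moot.
set_option linter.overlappingInstances false in
/-- **Orientation reversal preserves the parity**: `Q_{-X}` is even iff `Q_X` is even
(Milnor–Husemoller 1973, §II.2 and §V.1; Gompf–Stipsicz 1999, §1.2). [cite: MilnorHusemoller1973, §II.2 and §V.1]
(Binder repair 2026-08-16: `[CompactSpace X] [T2Space X]` is written in the header so that it is a
parameter of the elaborated constant; as a section instance unused by the body it was silently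
dropped, so the fact ranged over cases the printed theorem excludes.) -/
def isEven_intersectionForm_neg_iff [CompactSpace X] [T2Space X] : Prop :=
  ∀ (h : k + k = n) (μ : Literature.AlgebraicTopology.SingularHomology.HomologicalOrientation ℤ X n),
    (Literature.AlgebraicTopology.SingularHomology.intersectionForm h (-μ)).IsEven ↔ (Literature.AlgebraicTopology.SingularHomology.intersectionForm h μ).IsEven

/- interim proof relied on results that are now named facts (D-0014); demoted to a fact by the D-0014 sorry-sweep, proof preserved:
:= by
  rw [intersectionForm_neg, LinearMap.BilinForm.isEven_neg_iff]
-/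

/-- **Homeomorphism invariance of the signature**: for `e : Y ≃ₜ X` and the transported
orientation `μ.comap e` on `Y`, `σ(Q_Y) = σ(Q_X)` (Milnor–Husemoller 1973, §V.1; Gompf–Stipsicz
1999, §1.2). From G04's `equivalent_intersectionForm_comap`; as there, only `[TopologicalSpace Y]`
is assumed on `Y` (its manifold structure is that transported along `e`). [cite: MilnorHusemoller1973, §V.1] -/
def signature_intersectionForm_comap : Prop :=
  ∀ (h : k + k = n) (μ : Literature.AlgebraicTopology.SingularHomology.HomologicalOrientation ℤ X n) (e : Y ≃ₜ X),
    (Literature.AlgebraicTopology.SingularHomology.intersectionForm h (μ.comap e)).signature = (Literature.AlgebraicTopology.SingularHomology.intersectionForm h μ).signature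

/- interim proof relied on results that are now named facts (D-0014); demoted to a fact by the D-0014 sorry-sweep, proof preserved:
:=
  signature_eq_of_equivalent (equivalent_intersectionForm_comap h μ e)
-/

-- Binder repair (2026-08-16): the header instance deliberately shadows the section's, which a
-- `def` does not capture (it ranged too widely before); the overlapping-instances linter is moot.
set_option linter.overlappingInstances false in
/-- **Homeomorphism invariance of the parity**: for `e : Y ≃ₜ X` and the transported orientation
`μ.comap e` on `Y`, `Q_Y` is even iff `Q_X` is even (Milnor–Husemoller 1973, §V.1; Gompf–Stipsicz
1999, §1.2). [cite: MilnorHusemoller1973, §V.1]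
(Binder repair 2026-08-16: `[CompactSpace X] [T2Space X]` is written in the header so that it is a
parameter of the elaborated constant; as a section instance unused by the body it was silently
dropped, so the fact ranged over cases the printed theorem excludes.) -/
def isEven_intersectionForm_comap_iff [CompactSpace X] [T2Space X] : Prop :=
  ∀ (h : k + k = n) (μ : Literature.AlgebraicTopology.SingularHomology.HomologicalOrientation ℤ X n) (e : Y ≃ₜ X),
    (Literature.AlgebraicTopology.SingularHomology.intersectionForm h (μ.comap e)).IsEven ↔ (Literature.AlgebraicTopology.SingularHomology.intersectionForm h μ).IsEven

/- interim proof relied on results that are now named facts (D-0014); demoted to a fact by the D-0014 sorry-sweep, proof preserved: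
:=
  isEven_iff_of_equivalent (equivalent_intersectionForm_comap h μ e)
-/

-- Binder repair (2026-08-16): the header instance deliberately shadows the section's, which a
-- `def` does not capture (it ranged too widely before); the overlapping-instances linter is moot.
set_option linter.overlappingInstances false in
/-- On a closed *connected* manifold the absolute value `|σ(Q_X)|` of the signature does not depend
on the chosen `ℤ`-orientation, since the only orientations are `μ` and `-μ`
(Milnor–Husemoller 1973, §V.1; Gompf–Stipsicz 1999, §1.2). [cite: MilnorHusemoller1973, §V.1]
(Binder repair 2026-08-16: `[CompactSpace X] [T2Space X]` is written in the header so that it is a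
parameter of the elaborated constant; as a section instance unused by the body it was silently
dropped, so the fact ranged over cases the printed theorem excludes.) -/
def natAbs_signature_intersectionForm_eq_of_connectedSpace [CompactSpace X] [T2Space X] : Prop :=
  ∀ [ConnectedSpace X] (h : k + k = n) (μ ν : Literature.AlgebraicTopology.SingularHomology.HomologicalOrientation ℤ X n),
    (Literature.AlgebraicTopology.SingularHomology.intersectionForm h μ).signature.natAbs = (Literature.AlgebraicTopology.SingularHomology.intersectionForm h ν).signature.natAbs

/- interim proof relied on results that are now named facts (D-0014); demoted to a fact by the D-0014 sorry-sweep, proof preserved: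
:= by
  rcases HomologicalOrientation.eq_or_eq_neg_of_connected μ ν with rfl | rfl
  · rfl
  · rw [signature_intersectionForm_neg, Int.natAbs_neg]
-/

-- Binder repair (2026-08-16): the header instance deliberately shadows the section's, which a
-- `def` does not capture (it ranged too widely before); the overlapping-instances linter is moot.
set_option linter.overlappingInstances false in
/-- On a closed *connected* manifold the parity of the intersection form does not depend on the
chosen `ℤ`-orientation, since the only orientations are `μ` and `-μ`
(Milnor–Husemoller 1973, §V.1; Gompf–Stipsicz 1999, §1.2). [cite: MilnorHusemoller1973, §V.1]
(Binder repair 2026-08-16: `[CompactSpace X] [T2Space X]` is written in the header so that it is a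
parameter of the elaborated constant; as a section instance unused by the body it was silently
dropped, so the fact ranged over cases the printed theorem excludes.) -/
def isEven_intersectionForm_iff_of_connectedSpace [CompactSpace X] [T2Space X] : Prop :=
  ∀ [ConnectedSpace X] (h : k + k = n) (μ ν : Literature.AlgebraicTopology.SingularHomology.HomologicalOrientation ℤ X n),
    (Literature.AlgebraicTopology.SingularHomology.intersectionForm h μ).IsEven ↔ (Literature.AlgebraicTopology.SingularHomology.intersectionForm h ν).IsEven

/- interim proof relied on results that are now named facts (D-0014); demoted to a fact by the D-0014 sorry-sweep, proof preserved:
:= by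
  rcases HomologicalOrientation.eq_or_eq_neg_of_connected μ ν with rfl | rfl
  · rfl
  · exact isEven_intersectionForm_neg_iff h ν
-/

-- Binder repair (2026-08-16): the header instance deliberately shadows the section's, which a
-- `def` does not capture (it ranged too widely before); the overlapping-instances linter is moot.
set_option linter.overlappingInstances false in
/-- **`b_k = b_k⁺ + b_k⁻`.** For a closed `ℤ`-oriented `2k`-manifold with `k` even, the rank of
`Hᵏ(X; ℤ)/T` is the sum of the maximal ranks of positive and negative definite sublattices of
`Q_X` (Milnor–Husemoller 1973, §II.1 and §V.1; Gompf–Stipsicz 1999, §1.2). Restatement of G04's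
`sigPos_add_sigNeg_intersectionForm`. [cite: MilnorHusemoller1973, §II.1 and §V.1]
(Binder repair 2026-08-16: `[CompactSpace X] [T2Space X]` is written in the header so that it is a
parameter of the elaborated constant; as a section instance unused by the body it was silently
dropped, so the fact ranged over cases the printed theorem excludes.) -/
def finrank_eq_sigPos_add_sigNeg_intersectionForm [CompactSpace X] [T2Space X] : Prop :=
  ∀ (hk : Even k) (h : k + k = n) (μ : Literature.AlgebraicTopology.SingularHomology.HomologicalOrientation ℤ X n),
    Module.finrank ℤ ↥(Literature.AlgebraicTopology.SingularHomology.freeCohomology ℤ X k) =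
      sigPos (Literature.AlgebraicTopology.SingularHomology.intersectionForm h μ).toQuadraticMap + sigNeg (Literature.AlgebraicTopology.SingularHomology.intersectionForm h μ).toQuadraticMap

/- interim proof relied on results that are now named facts (D-0014); demoted to a fact by the D-0014 sorry-sweep, proof preserved:
:=
  (sigPos_add_sigNeg_intersectionForm hk h μ).symm
-/

end Transport

/-! ### Dimension four: the signature of an oriented closed 4-manifold -/

section HomologicalOrientation
open Literature.AlgebraicTopology.SingularHomology (HomologicalOrientation)
open Literature.AlgebraicTopology.SingularHomology.HomologicalOrientation

/-- The **signature** `σ(M, μ) ∈ ℤ` of a closed `ℤ`-oriented topological `4`-manifold: the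
signature `b₂⁺ - b₂⁻` of its intersection form on `H²(M; ℤ)/T` (Milnor–Husemoller 1973, §II.2 and
§V.1; Gompf–Stipsicz 1999, §1.2.6). Dot notation on G04's `Literature.AlgebraicTopology.SingularHomology.HomologicalOrientation` (inside
`Literature`). As `Literature.AlgebraicTopology.SingularHomology.intersectionForm`, only `[TopologicalSpace M]` is assumed; the value is meaningful
for `[T2Space M] [ChartedSpace (𝔼 4) M] [CompactSpace M]` (otherwise `[M]` and hence the form may
be the junk value `0`, and `signature = 0`). The degree equation is Mathlib's
`two_add_two_eq_four`. [cite: MilnorHusemoller1973, §II.2 and §V.1] -/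
abbrev _root_.Literature.AlgebraicTopology.SingularHomology.HomologicalOrientation.signature {M : Type u} [TopologicalSpace M] (μ : HomologicalOrientation ℤ M 4) : ℤ :=
  (Literature.AlgebraicTopology.SingularHomology.intersectionForm two_add_two_eq_four μ).signature

variable {M : Type u} [TopologicalSpace M] [T2Space M] [ChartedSpace (𝔼 4) M] [CompactSpace M]
  {N : Type u} [TopologicalSpace N]

/-- Reversing the orientation negates the signature of a closed oriented `4`-manifold:
`σ(M, -μ) = -σ(M, μ)`, i.e. `σ(M̄) = -σ(M)` (Gompf–Stipsicz 1999, §1.2, after Def. 1.2.1;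
Milnor–Husemoller 1973, §V.1). [cite: GompfStipsicz1999, §1.2  after Def. 1.2.1] -/
def _root_.Literature.AlgebraicTopology.SingularHomology.HomologicalOrientation.signature_neg : Prop :=
  ∀ (μ : HomologicalOrientation ℤ M 4),
    (-μ).signature = -μ.signature

/- interim proof relied on results that are now named facts (D-0014); demoted to a fact by the D-0014 sorry-sweep, proof preserved:
:=
  signature_intersectionForm_neg two_add_two_eq_four μ
-/

-- Binder repair (2026-08-16): the header instance deliberately shadows the section's, which a
-- `def` does not capture (it ranged too widely before); the overlapping-instances linter is moot.
set_option linter.overlappingInstances false in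
/-- The signature of a closed oriented `4`-manifold is invariant under homeomorphisms respecting
the orientations: `σ(N, μ.comap e) = σ(M, μ)` for `e : N ≃ₜ M` (Gompf–Stipsicz 1999, §1.2;
Milnor–Husemoller 1973, §V.1). [cite: GompfStipsicz1999, §1.2]
(Binder repair 2026-08-16: `[T2Space M] [CompactSpace M]` is written in the header so that it is a
parameter of the elaborated constant; as a section instance unused by the body it was silently
dropped, so the fact ranged over cases the printed theorem excludes.) -/
def _root_.Literature.AlgebraicTopology.SingularHomology.HomologicalOrientation.signature_comap
    [T2Space M] [CompactSpace M] : Prop :=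
  ∀ (μ : HomologicalOrientation ℤ M 4) (e : N ≃ₜ M),
    (μ.comap e).signature = μ.signature

/- interim proof relied on results that are now named facts (D-0014); demoted to a fact by the D-0014 sorry-sweep, proof preserved:
:=
  signature_intersectionForm_comap two_add_two_eq_four μ e
-/

-- Binder repair (2026-08-16): the header instance deliberately shadows the section's, which a
-- `def` does not capture (it ranged too widely before); the overlapping-instances linter is moot.
set_option linter.overlappingInstances false in
/-- On a closed connected `4`-manifold, `|σ(M, μ)|` does not depend on the orientation
(Gompf–Stipsicz 1999, §1.2; Milnor–Husemoller 1973, §V.1). [cite: GompfStipsicz1999, §1.2]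
(Binder repair 2026-08-16: `[T2Space M] [CompactSpace M]` is written in the header so that it is a
parameter of the elaborated constant; as a section instance unused by the body it was silently
dropped, so the fact ranged over cases the printed theorem excludes.) -/
def _root_.Literature.AlgebraicTopology.SingularHomology.HomologicalOrientation.natAbs_signature_eq_of_connectedSpace
    [T2Space M] [CompactSpace M] : Prop :=
  ∀ [ConnectedSpace M] (μ ν : HomologicalOrientation ℤ M 4),
    μ.signature.natAbs = ν.signature.natAbs

/- interim proof relied on results that are now named facts (D-0014); demoted to a fact by the D-0014 sorry-sweep, proof preserved:
:=
  natAbs_signature_intersectionForm_eq_of_connectedSpace two_add_two_eq_four μ ν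
-/

end HomologicalOrientation

/-! ### Bridge: smooth orientations vs homological `ℤ`-orientations -/

section Bridge

variable (X : Type u) [TopologicalSpace X] [T2Space X] [SecondCountableTopology X] {n : ℕ}
  [ChartedSpace (𝔼 n) X] [IsManifold (𝓡 n) 1 X]

/-- A smoothly orientable `C¹` manifold is `ℤ`-orientable in the homological sense: a consistent
orientation of the tangent spaces determines consistent generators of `Hₙ(X | x; ℤ)`
(Bredon, *Topology and Geometry*, VI.7, Thm. 7.15 ff.; Milnor–Stasheff 1974, Appendix A). [cite: MilnorStasheff1974, Appendix A] -/
def isOrientableOver_int_of_isOrientable : Prop :=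
  ∀ (h : IsOrientable (𝓡 n) X),
    Literature.AlgebraicTopology.SingularHomology.IsOrientableOver ℤ X n

/-- For a `C¹` manifold, smooth orientability (consistent orientations of tangent spaces) is
equivalent to homological `ℤ`-orientability (consistent generators of local homology)
(Bredon, *Topology and Geometry*, VI.7; Milnor–Stasheff 1974, Appendix A). [cite: MilnorStasheff1974, Appendix A] -/
def isOrientable_iff_isOrientableOver_int : Prop :=
  IsOrientable (𝓡 n) X ↔ Literature.AlgebraicTopology.SingularHomology.IsOrientableOver ℤ X n

omit [SecondCountableTopology X] [IsManifold (𝓡 n) 1 X] in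
/-- A simply connected topological `n`-manifold carries a homological `ℤ`-orientation
(Hatcher 2002, §3.3, Prop. 3.25 ff.); this is G04's `isOrientableOver_int_of_simplyConnectedSpace`
unfolded to `Nonempty`, for use with `obtain ⟨μ⟩ := …`. [cite: Hatcher2002, §3.3  Prop. 3.25 ff] -/
def nonempty_homologicalOrientation_int_of_simplyConnectedSpace : Prop :=
  ∀ [SimplyConnectedSpace X],
    Nonempty (Literature.AlgebraicTopology.SingularHomology.HomologicalOrientation ℤ X n)

/- interim proof relied on results that are now named facts (D-0014); demoted to a fact by the D-0014 sorry-sweep, proof preserved: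
:=
  isOrientableOver_int_of_simplyConnectedSpace
-/

end Bridge

end Literature.Topology.FourManifolds

end
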